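import Summits.CriticalPhenomena.CardyFormulaZ2.Theorems.CardyComplexConeEdgePrecompactCollarAgreement
import Summits.CriticalPhenomena.CardyFormulaZ2.Theorems.CardyComplexConeEdgePrecompactResponseLocalisation

/-!
# Two dynamics at one medial vertex: merging only at discrepancy edges, and the synthesis of corner-disjoint strands
(line `qkz-strip-boundary-arm` of crux `CardyComplexCone.EdgePrecompact`, stmt-CriticalPhenomena-11387;
tool for items 3–4 of the road map for the uniform forward response stability "UFRS", module
docstring of `Theorems/CardyComplexConeEdgePrecompactUniformForwardResponseStability.lean`)

UFRS compares the orbits of Smirnov's successor map `nextCorner` in TWO configurations, the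
completed configuration `β₀ = E.bcBondConfig ω` of a datum and `β₁ = (shiftData E w).bcBondConfig ω`
of its translate, read in one `ω`. Items 3–4 of the road map use, for the strands `W₀, R₀`
(pieces of a `β₀`-orbit) and `R₁` (a piece of a `β₁`-orbit), the planar facts "medial strands
never cross, not even across the two configurations" and "a merge of the two dynamics reads a
discrepancy edge". This file proves the lattice-level statements behind both, for ARBITRARY
`β₀, β₁`:

* `eq_or_eq_opp_of_cTgt_eq` — the two in-darts of a medial vertex: corners with the same target
  edge are equal or OPPOSITE (`(x, k)` and `(x + u_{k+1}, k + 2)`);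
* `nextCorner_ne_of_iff` / `cTgt_not_iff_of_nextCorner_eq` — **merging reads a discrepancy**: if
  two distinct corners are sent to the SAME corner by the two dynamics, they are the two in-darts
  of one medial vertex and that edge has DIFFERENT status in `β₀` and `β₁` (equal status pairs the
  two in-darts with the two out-darts bijectively); conversely `nextCorner_eq_of_not_iff`;
* `iff_of_nextCorner_ne` — **dart-disjoint strands agree on the edges they share**: if the two
  in-darts of a medial vertex are sent to DIFFERENT corners by the two dynamics, the edge has the
  same status in both;
* `exists_merge_or_through` — tracing a coincidence `O₀ c₀ i = O₁ c₁ j` backwards: either one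
  orbit passes through the other's initial corner, or there is a MERGE (distinct corners at times
  `s`, `t`, equal corners at `s + 1`, `t + 1`), which by the above sits at a discrepancy edge;
* `whiskerContact` — the trace-back applied to case (A) of `splitStrands`: there the run
  `R₁ = O₁ e (0, T]` of the second dynamics avoids the outgoing run `O₀ c₀ (m, n]` but MAY meet the
  incoming whisker `O₀ c₀ [0, m)`; every such contact comes from a MERGE at a discrepancy edge, or
  `R₁` passes through the initial corner `c₀` (so the road map's "three pairwise dart-disjoint
  strands" of item 3 hold up to collar merges of `R₁` into the whisker and this passage);
* `strandSynthesis` — **one configuration for two corner-disjoint strands**: if the stretches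
  `O₀ c₀ [0, n₀]` (dynamics `β₀`) and `O₁ c₁ [0, n₁]` (dynamics `β₁`) share no corner, there is ONE
  configuration `β` (between `β₀ ∩ β₁` and `β₀ ∪ β₁`) of which both are orbit stretches, with the
  same turns — so that the single-configuration planar theory of the tree (`exists_orbitArms`,
  `MedialTrailUmlaufsatz`, `MedialCycleSeparation`) applies to pairs of strands of the two dynamics;
* `ufrs_mergeCollar` — in UFRS (registered vocabulary): for fine admissible data of `D`, a merge of
  the two dynamics happens at a corner of the `3η`-collar (`collarAgreement`,
  `no_discrepancy_of_agree`): the twin of the collar localisation of SPLITS in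
  `ufrs_failureStructure`.

References: S. Smirnov, C. R. Acad. Sci. Paris 333 (2001), §2 (the turning rule as a bijection on
darts); G. Grimmett, *The Random-Cluster Model* (2006), §6.1 (loops of the loop representation do
not cross).
-/

namespace Summit.CriticalPhenomena.CardyFormulaZ2.Cruxes.EdgePrecompact.QkzStripBoundaryArm

open MeasureTheory Filter Set Metric
open scoped Topology BigOperators Pointwise
open Literature.Probability.LatticeModels Literature.Probability.Percolation
open Literature.Probability.RandomPlanarGeometry (DobrushinDomain)
open Summit.CriticalPhenomena.CardyFormulaZ2.Theses.CardyComplexCone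

noncomputable section

/-! ## The two in-darts of a medial vertex -/

/-- The corner opposite to `p = (x, k)` at its target edge: `(x + u_{k+1}, k + 2)`, the other
corner whose target edge is `cTgt p`. -/
theorem cTgt_opp (p : Site 2 × Fin 4) :
    cTgt ((p.1 + cornerUnit (p.2 + 1), p.2 + 2) : Site 2 × Fin 4) = cTgt p := by
  rw [cTgt, cTgt]
  simp only
  rw [show p.2 + 2 + 1 = p.2 + 1 + 2 by abel_nf, cornerUnit_add_two, ← sub_eq_add_neg,
    add_sub_cancel_right, Sym2.eq_swap]

/-- **The two in-darts of a medial vertex.** Corners with the same target edge are equal or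
opposite. -/
theorem eq_or_eq_opp_of_cTgt_eq {p p' : Site 2 × Fin 4} (h : cTgt p = cTgt p') :
    p' = p ∨ p' = (p.1 + cornerUnit (p.2 + 1), p.2 + 2) := by
  obtain ⟨x, k⟩ := p
  obtain ⟨y, j⟩ := p'
  simp only [cTgt] at h
  rcases Sym2.eq_iff.1 h with ⟨h1, h2⟩ | ⟨h1, h2⟩
  · left
    subst h1
    have hk : k + 1 = j + 1 := cornerUnit_injective (add_left_cancel h2)
    rw [Prod.mk.injEq]
    exact ⟨rfl, (add_right_cancel hk).symm⟩
  · right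
    have hy : y = x + cornerUnit (k + 1) := h2.symm
    subst hy
    have hu : cornerUnit (j + 1) = cornerUnit (k + 1 + 2) := by
      rw [cornerUnit_add_two]
      have := h1
      rw [add_assoc] at this
      have h3 : cornerUnit (k + 1) + cornerUnit (j + 1) = 0 := by
        simpa using this.symm
      exact eq_neg_of_add_eq_zero_right h3
    have hj : j = k + 2 := by
      have := cornerUnit_injective hu
      have h4 : j + 1 = k + 2 + 1 := by rw [this]; abel
      exact add_right_cancel h4
    subst hj
    rfl

/-- The opposite corner is a different corner. -/
theorem opp_ne (p : Site 2 × Fin 4) : ((p.1 + cornerUnit (p.2 + 1), p.2 + 2) : Site 2 × Fin 4) ≠ p := by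
  intro h
  have := congrArg Prod.fst h
  simp only at this
  exact cornerUnit_ne_zero (p.2 + 1) (by simpa using this)

/-! ## Successors of the two in-darts under two dynamics -/

/-- Successor of the opposite corner across an OPEN edge: `(x, k + 1)`. -/
theorem nextCorner_opp_of_mem {β : BondConfig (Site 2)} {p : Site 2 × Fin 4} (h : cTgt p ∈ β) :
    nextCorner β ((p.1 + cornerUnit (p.2 + 1), p.2 + 2) : Site 2 × Fin 4) = (p.1, p.2 + 1) := by
  have h' : cTgt ((p.1 + cornerUnit (p.2 + 1), p.2 + 2) : Site 2 × Fin 4) ∈ β := by rwa [cTgt_opp]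
  rw [nextCorner_of_mem h']
  simp only
  rw [show p.2 + 2 + 1 = p.2 + 1 + 2 by abel_nf, cornerUnit_add_two, ← sub_eq_add_neg,
    add_sub_cancel_right, Prod.mk.injEq]
  exact ⟨rfl, by abel_nf⟩

/-- Successor of the opposite corner across a CLOSED edge: `(x + u_{k+1}, k + 3)`. -/
theorem nextCorner_opp_of_not_mem {β : BondConfig (Site 2)} {p : Site 2 × Fin 4} (h : cTgt p ∉ β) :
    nextCorner β ((p.1 + cornerUnit (p.2 + 1), p.2 + 2) : Site 2 × Fin 4) =
      (p.1 + cornerUnit (p.2 + 1), p.2 + 3) := by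
  have h' : cTgt ((p.1 + cornerUnit (p.2 + 1), p.2 + 2) : Site 2 × Fin 4) ∉ β := by rwa [cTgt_opp]
  rw [nextCorner_of_not_mem h', Prod.mk.injEq]
  have h3 : ∀ k : Fin 4, k + 2 + 1 = k + 3 := by decide
  exact ⟨rfl, h3 p.2⟩

/-- **Equal status pairs in-darts and out-darts bijectively**: if the edge has the same status in
`β₀` and `β₁`, the two in-darts are sent to different corners. -/
theorem nextCorner_ne_of_iff {β₀ β₁ : BondConfig (Site 2)} {p p' : Site 2 × Fin 4}
    (ht : cTgt p = cTgt p') (hne : p ≠ p') (hiff : cTgt p ∈ β₀ ↔ cTgt p ∈ β₁) :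
    nextCorner β₀ p ≠ nextCorner β₁ p' := by
  rcases eq_or_eq_opp_of_cTgt_eq ht with rfl | rfl
  · exact absurd rfl hne
  · intro h
    by_cases h₀ : cTgt p ∈ β₀
    · rw [nextCorner_of_mem h₀, nextCorner_opp_of_mem (hiff.1 h₀), Prod.mk.injEq] at h
      exact cornerUnit_ne_zero (p.2 + 1) (by simpa using h.1)
    · rw [nextCorner_of_not_mem h₀, nextCorner_opp_of_not_mem (fun h₁ => h₀ (hiff.2 h₁)),
        Prod.mk.injEq] at h
      exact cornerUnit_ne_zero (p.2 + 1) (by simpa using h.1.symm)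

/-- **Different status merges the two in-darts**: if the edge has different status in `β₀` and
`β₁`, the two in-darts are sent to the SAME corner (`β₀` applied to one, `β₁` to the other). -/
theorem nextCorner_eq_of_not_iff {β₀ β₁ : BondConfig (Site 2)} {p p' : Site 2 × Fin 4}
    (ht : cTgt p = cTgt p') (hne : p ≠ p') (hst : ¬ (cTgt p ∈ β₀ ↔ cTgt p ∈ β₁)) :
    nextCorner β₀ p = nextCorner β₁ p' := by
  rcases eq_or_eq_opp_of_cTgt_eq ht with rfl | rfl
  · exact absurd rfl hne
  · by_cases h₀ : cTgt p ∈ β₀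
    · have h₁ : cTgt p ∉ β₁ := fun h₁ => hst ⟨fun _ => h₁, fun _ => h₀⟩
      rw [nextCorner_of_mem h₀, nextCorner_opp_of_not_mem h₁]
    · have h₁ : cTgt p ∈ β₁ := by
        by_contra h₁; exact hst ⟨fun h => absurd h h₀, fun h => absurd h h₁⟩
      rw [nextCorner_of_not_mem h₀, nextCorner_opp_of_mem h₁]

/-- **Merging reads a discrepancy edge.** If two distinct corners are sent to the same corner by
the two dynamics, they are the two in-darts of one medial vertex, and that edge has different
status in `β₀` and `β₁`. -/
theorem cTgt_not_iff_of_nextCorner_eq {β₀ β₁ : BondConfig (Site 2)} {p p' : Site 2 × Fin 4}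
    (hne : p ≠ p') (h : nextCorner β₀ p = nextCorner β₁ p') :
    cTgt p = cTgt p' ∧ p' = (p.1 + cornerUnit (p.2 + 1), p.2 + 2) ∧
      ¬ (cTgt p ∈ β₀ ↔ cTgt p ∈ β₁) := by
  have ht : cTgt p = cTgt p' := by rw [← cSrc_nextCorner (β := β₀) p, h, cSrc_nextCorner]
  refine ⟨ht, (eq_or_eq_opp_of_cTgt_eq ht).resolve_left (Ne.symm hne), fun hiff => ?_⟩
  exact nextCorner_ne_of_iff ht hne hiff h

/-- **Dart-disjoint strands agree on shared edges.** If the two in-darts of a medial vertex are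
sent to different corners by the two dynamics, the edge has the same status in both. -/
theorem iff_of_nextCorner_ne {β₀ β₁ : BondConfig (Site 2)} {p p' : Site 2 × Fin 4}
    (ht : cTgt p = cTgt p') (hne : p ≠ p') (hsucc : nextCorner β₀ p ≠ nextCorner β₁ p') :
    cTgt p ∈ β₀ ↔ cTgt p ∈ β₁ := by
  by_contra hst
  exact hsucc (nextCorner_eq_of_not_iff ht hne hst)

/-! ## Tracing a coincidence back to a merge -/

/-- **Merge or through.** If `O₀ c₀ i = O₁ c₁ j`, then EITHER there is a merge — times `s < i`,
`t < j` at equal distance from the coincidence with `O₀ c₀ s ≠ O₁ c₁ t` but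
`O₀ c₀ (s + 1) = O₁ c₁ (t + 1)` (and agreement from there on up to `i`, `j`) — OR the two stretches
agree all the way back: `j ≤ i` and `O₀ c₀ (i - j) = c₁`, or `i ≤ j` and `O₁ c₁ (j - i) = c₀`. -/
theorem exists_merge_or_through (β₀ β₁ : BondConfig (Site 2)) (c₀ c₁ : Site 2 × Fin 4) :
    ∀ (d i j : ℕ), d = min i j → cornerOrbit β₀ c₀ i = cornerOrbit β₁ c₁ j →
      (∃ s t : ℕ, s < i ∧ t < j ∧ i - s = j - t ∧ cornerOrbit β₀ c₀ s ≠ cornerOrbit β₁ c₁ t ∧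
        ∀ r, r ≤ i - s - 1 → cornerOrbit β₀ c₀ (s + 1 + r) = cornerOrbit β₁ c₁ (t + 1 + r)) ∨
      (j ≤ i ∧ cornerOrbit β₀ c₀ (i - j) = c₁) ∨ (i ≤ j ∧ cornerOrbit β₁ c₁ (j - i) = c₀) := by
  intro d
  induction d with
  | zero =>
    intro i j hd h
    rcases Nat.eq_zero_or_pos i with rfl | hi
    · right; right
      exact ⟨Nat.zero_le j, by rw [Nat.sub_zero]; exact h.symm⟩
    · have hj : j = 0 := by omega
      subst hj
      right; left
      exact ⟨Nat.zero_le i, by rw [Nat.sub_zero]; exact h⟩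
  | succ d ih =>
    intro i j hd h
    obtain ⟨i', rfl⟩ : ∃ i', i = i' + 1 := ⟨i - 1, by omega⟩
    obtain ⟨j', rfl⟩ : ∃ j', j = j' + 1 := ⟨j - 1, by omega⟩
    by_cases heq : cornerOrbit β₀ c₀ i' = cornerOrbit β₁ c₁ j'
    · rcases ih i' j' (by omega) heq with ⟨s, t, hs, htj, hst, hne, hagree⟩ | ⟨hji, hc⟩ | ⟨hij, hc⟩
      · left
        refine ⟨s, t, Nat.lt_succ_of_lt hs, Nat.lt_succ_of_lt htj, by omega, hne, fun r hr => ?_⟩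
        rcases Nat.lt_or_ge r (i' - s) with hr' | hr'
        · rcases Nat.lt_or_ge r (i' - s - 1 + 1) with hr'' | hr''
          · rcases Nat.eq_or_lt_of_le (Nat.le_of_lt_succ hr'') with rfl | hr3
            · -- r = i' - s - 1 + ... careful: r = i' - s - 1 handled by hagree when s + 1 ≤ i'
              exact hagree _ le_rfl
            · exact hagree r (by omega)
          · omega
        · -- r = i' - s: the coincidence at (i'+1, j'+1)
          have hr2 : r = i' - s := by omega
          subst hr2
          have h1 : s + 1 + (i' - s) = i' + 1 := by omega
          have h2 : t + 1 + (i' - s) = j' + 1 := by omega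
          rw [h1, h2]
          exact h
      · right; left
        exact ⟨Nat.succ_le_succ hji, by rwa [Nat.succ_sub_succ]⟩
      · right; right
        exact ⟨Nat.succ_le_succ hij, by rwa [Nat.succ_sub_succ]⟩
    · left
      refine ⟨i', j', Nat.lt_succ_self _, Nat.lt_succ_self _, by omega, heq, fun r hr => ?_⟩
      have hr0 : r = 0 := by omega
      subst hr0
      simpa using h

/-- **Merge or through**, without the auxiliary induction parameter. -/
theorem merge_or_through {β₀ β₁ : BondConfig (Site 2)} {c₀ c₁ : Site 2 × Fin 4} {i j : ℕ}
    (h : cornerOrbit β₀ c₀ i = cornerOrbit β₁ c₁ j) :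
    (∃ s t : ℕ, s < i ∧ t < j ∧ i - s = j - t ∧ cornerOrbit β₀ c₀ s ≠ cornerOrbit β₁ c₁ t ∧
        ∀ r, r ≤ i - s - 1 → cornerOrbit β₀ c₀ (s + 1 + r) = cornerOrbit β₁ c₁ (t + 1 + r)) ∨
      (j ≤ i ∧ cornerOrbit β₀ c₀ (i - j) = c₁) ∨ (i ≤ j ∧ cornerOrbit β₁ c₁ (j - i) = c₀) :=
  exists_merge_or_through β₀ β₁ c₀ c₁ (min i j) i j rfl h

/-- At a merge the merged edge is a discrepancy edge (orbit form of `cTgt_not_iff_of_nextCorner_eq`). -/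
theorem cTgt_not_iff_of_merge {β₀ β₁ : BondConfig (Site 2)} {c₀ c₁ : Site 2 × Fin 4} {s t : ℕ}
    (hne : cornerOrbit β₀ c₀ s ≠ cornerOrbit β₁ c₁ t)
    (h : cornerOrbit β₀ c₀ (s + 1) = cornerOrbit β₁ c₁ (t + 1)) :
    cTgt (cornerOrbit β₀ c₀ s) = cTgt (cornerOrbit β₁ c₁ t) ∧
      ¬ (cTgt (cornerOrbit β₀ c₀ s) ∈ β₀ ↔ cTgt (cornerOrbit β₀ c₀ s) ∈ β₁) := by
  have h' : nextCorner β₀ (cornerOrbit β₀ c₀ s) = nextCorner β₁ (cornerOrbit β₁ c₁ t) := h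
  obtain ⟨ht, -, hst⟩ := cTgt_not_iff_of_nextCorner_eq hne h'
  exact ⟨ht, hst⟩

/-! ## One configuration for two corner-disjoint strands -/

/-- **Synthesis of corner-disjoint strands.** If the stretches `O₀ c₀ [0, n₀]` of the dynamics
`β₀` and `O₁ c₁ [0, n₁]` of the dynamics `β₁` share no corner, there is one configuration `β`,
with `β₀ ∩ β₁ ⊆ β ⊆ β₀ ∪ β₁`, reading the target edges of the first stretch as `β₀` does and those
of the second as `β₁` does; both stretches are stretches of `β`-orbits, with the same turns.
(At a medial vertex entered by both stretches — through its two opposite in-darts — the two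
out-darts are distinct corners of the two stretches, so the two statuses agree:
`iff_of_nextCorner_ne`.) -/
theorem strandSynthesis : ∀ (β₀ β₁ : BondConfig (Site 2)) (c₀ c₁ : Site 2 × Fin 4) (n₀ n₁ : ℕ), (∀ i ≤ n₀, ∀ j ≤ n₁, cornerOrbit β₀ c₀ i ≠ cornerOrbit β₁ c₁ j) → ∃ β : BondConfig (Site 2), β₀ ∩ β₁ ⊆ β ∧ β ⊆ β₀ ∪ β₁ ∧ (∀ i < n₀, (cTgt (cornerOrbit β₀ c₀ i) ∈ β ↔ cTgt (cornerOrbit β₀ c₀ i) ∈ β₀)) ∧ (∀ j < n₁, (cTgt (cornerOrbit β₁ c₁ j) ∈ β ↔ cTgt (cornerOrbit β₁ c₁ j) ∈ β₁)) ∧ (∀ i ≤ n₀, cornerOrbit β c₀ i = cornerOrbit β₀ c₀ i) ∧ (∀ j ≤ n₁, cornerOrbit β c₁ j = cornerOrbit β₁ c₁ j) ∧ (∀ i < n₀, turnOf β (cornerOrbit β₀ c₀ i) = turnOf β₀ (cornerOrbit β₀ c₀ i)) ∧ (∀ j < n₁, turnOf β (cornerOrbit β₁ c₁ j) = turnOf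 β₁ (cornerOrbit β₁ c₁ j)) := by
  intro β₀ β₁ c₀ c₁ n₀ n₁ hdisj
  classical
  set T₀ : Set (Sym2 (Site 2)) := {e | ∃ i < n₀, cTgt (cornerOrbit β₀ c₀ i) = e} with hT₀
  set β : BondConfig (Site 2) := {e | (e ∈ β₀ ∧ e ∈ T₀) ∨ (e ∈ β₁ ∧ e ∉ T₀)} with hβ
  have hread₀ : ∀ i < n₀, (cTgt (cornerOrbit β₀ c₀ i) ∈ β ↔ cTgt (cornerOrbit β₀ c₀ i) ∈ β₀) := by
    intro i hi
    have hmem : cTgt (cornerOrbit β₀ c₀ i) ∈ T₀ := ⟨i, hi, rfl⟩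
    simp only [hβ, Set.mem_setOf_eq]
    tauto
  have hread₁ : ∀ j < n₁, (cTgt (cornerOrbit β₁ c₁ j) ∈ β ↔ cTgt (cornerOrbit β₁ c₁ j) ∈ β₁) := by
    intro j hj
    by_cases hmem : cTgt (cornerOrbit β₁ c₁ j) ∈ T₀
    · obtain ⟨i, hi, hti⟩ := hmem
      -- a shared medial vertex: the two statuses agree
      have hagree : cTgt (cornerOrbit β₀ c₀ i) ∈ β₀ ↔ cTgt (cornerOrbit β₀ c₀ i) ∈ β₁ :=
        iff_of_nextCorner_ne hti (hdisj i hi.le j hj.le) (hdisj (i + 1) hi (j + 1) hj)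
      rw [← hti, hread₀ i hi, hagree]
    · simp only [hβ, Set.mem_setOf_eq]
      tauto
  have horb₀ : ∀ i ≤ n₀, cornerOrbit β c₀ i = cornerOrbit β₀ c₀ i := by
    intro i hi
    induction i with
    | zero => rfl
    | succ i ih =>
      show nextCorner β (cornerOrbit β c₀ i) = nextCorner β₀ (cornerOrbit β₀ c₀ i)
      rw [ih (Nat.le_of_succ_le hi)]
      exact nextCorner_congr_of_iff (hread₀ i hi)
  have horb₁ : ∀ j ≤ n₁, cornerOrbit β c₁ j = cornerOrbit β₁ c₁ j := by
    intro j hj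
    induction j with
    | zero => rfl
    | succ j ih =>
      show nextCorner β (cornerOrbit β c₁ j) = nextCorner β₁ (cornerOrbit β₁ c₁ j)
      rw [ih (Nat.le_of_succ_le hj)]
      exact nextCorner_congr_of_iff (hread₁ j hj)
  refine ⟨β, fun e he => ?_, fun e he => ?_, hread₀, hread₁, horb₀, horb₁,
    fun i hi => turnOf_congr_of_iff (hread₀ i hi), fun j hj => turnOf_congr_of_iff (hread₁ j hj)⟩
  · simp only [hβ, Set.mem_setOf_eq]
    by_cases h : e ∈ T₀
    · exact Or.inl ⟨he.1, h⟩
    · exact Or.inr ⟨he.2, h⟩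
  · simp only [hβ, Set.mem_setOf_eq] at he
    rcases he with ⟨h, -⟩ | ⟨h, -⟩
    · exact Or.inl h
    · exact Or.inr h

/-! ## Contacts of the second run with the incoming whisker (case (A) of `splitStrands`) -/

/-- **Whisker contacts are merges, or a passage through the initial corner.** Setting of
`splitStrands`: the simple stretch `O₀ c₀ [0, n]`, the corner `e = O₀ c₀ m`, `m ≤ n`, and the
`β₁`-orbit of `e`. If that orbit meets the INCOMING WHISKER — `O₁ e j = O₀ c₀ i` with `1 ≤ j` and
`i < m` (in case (A) of `splitStrands` every contact with `O₀ c₀ [0, n]` is of this kind) — then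
EITHER there is a MERGE before it (`O₀ c₀ s ≠ O₁ e t`, `O₀ c₀ (s+1) = O₁ e (t+1)`, `s < i`,
`t < j`, the merged edge a discrepancy edge), OR the `β₁`-orbit of `e` passes through the initial
corner `c₀` at time `j - i ≥ 1` (`i ≤ j`). (The third alternative of `merge_or_through`, the
`β₀`-stretch passing through `e` before time `m`, contradicts simplicity.) -/
theorem whiskerContact {β₀ β₁ : BondConfig (Site 2)} {c₀ : Site 2 × Fin 4} {m n i j : ℕ}
    (hsimple : ∀ i j : ℕ, i ≤ n → j ≤ n → cornerOrbit β₀ c₀ i = cornerOrbit β₀ c₀ j → i = j)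
    (hmn : m ≤ n) (hj : 1 ≤ j) (him : i < m)
    (h : cornerOrbit β₁ (cornerOrbit β₀ c₀ m) j = cornerOrbit β₀ c₀ i) :
    (∃ s t : ℕ, s < i ∧ t < j ∧ i - s = j - t ∧
        cornerOrbit β₀ c₀ s ≠ cornerOrbit β₁ (cornerOrbit β₀ c₀ m) t ∧
        cornerOrbit β₀ c₀ (s + 1) = cornerOrbit β₁ (cornerOrbit β₀ c₀ m) (t + 1) ∧
        cTgt (cornerOrbit β₀ c₀ s) = cTgt (cornerOrbit β₁ (cornerOrbit β₀ c₀ m) t) ∧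
        ¬ (cTgt (cornerOrbit β₀ c₀ s) ∈ β₀ ↔ cTgt (cornerOrbit β₀ c₀ s) ∈ β₁)) ∨
      (i + 1 ≤ j ∧ cornerOrbit β₁ (cornerOrbit β₀ c₀ m) (j - i) = c₀) := by
  rcases merge_or_through (β₀ := β₀) (β₁ := β₁) (c₀ := c₀) (c₁ := cornerOrbit β₀ c₀ m) h.symm with
    ⟨s, t, hs, ht, hst, hne, hagree⟩ | ⟨hji, hthrough⟩ | ⟨hij, hthrough⟩
  · left
    have hmerge : cornerOrbit β₀ c₀ (s + 1) = cornerOrbit β₁ (cornerOrbit β₀ c₀ m) (t + 1) := by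
      have := hagree 0 (Nat.zero_le _)
      simpa using this
    obtain ⟨htgt, hst'⟩ := cTgt_not_iff_of_merge hne hmerge
    exact ⟨s, t, hs, ht, hst, hne, hmerge, htgt, hst'⟩
  · -- the `β₀`-stretch would pass through `e = O₀ c₀ m` at time `i - j < m`
    exfalso
    have := hsimple (i - j) m (by omega) hmn hthrough
    omega
  · right
    refine ⟨?_, hthrough⟩
    -- `j = i` would give `e = c₀`, i.e. `m = 0` by simplicity, contradicting `i < m`
    rcases Nat.lt_or_ge i j with hlt | hge
    · exact hlt
    · exfalso
      have hji : j = i := le_antisymm hge hij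
      subst hji
      rw [Nat.sub_self] at hthrough
      have := hsimple m 0 hmn (Nat.zero_le n) hthrough
      omega

/-! ## In UFRS: the two dynamics merge only in the collar -/

/-- **Merges sit in the collar** (UFRS vocabulary). For `η > 0` there is `δ₀ > 0` such that for
every admissible datum `E` of `D` with `E.δ < δ₀`, shift `w` with `‖E.δ w‖ < η` and configuration
`ω`: if two distinct corners `p ≠ p'` are sent to the same corner by the completed dynamics of
`E` and of `shiftData E w` respectively, the vertex of `p` lies in the `3η`-collar of `∂D`
(off the collar the two completed statuses of every target edge coincide, `collarAgreement`). In
particular (orbit form) every MERGE of a `β₀`-orbit with a `β₁`-orbit produced by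
`exists_merge_or_through` happens at a collar corner. -/
theorem ufrs_mergeCollar : ∀ (D : DobrushinDomain) (η : ℝ), 0 < η → ∃ δ₀ > (0:ℝ), ∀ E : DiscreteDobrushin, E.Ω = D.carrier → E.IsZdAdmissible → E.δ < δ₀ → ∀ w : Site 2, ‖meshPoint E.δ w‖ < η → ∀ (ω : BondConfig (Site 2)) (p p' : Site 2 × Fin 4), p ≠ p' → nextCorner (E.bcBondConfig ω) p = nextCorner ((shiftData E w).bcBondConfig ω) p' → infDist (meshPoint E.δ p.1) D.carrierᶜ < 3 * η ∧ cTgt p = cTgt p' ∧ ¬ (cTgt p ∈ E.bcBondConfig ω ↔ cTgt p ∈ (shiftData E w).bcBondConfig ω) := by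
  intro D η hη
  obtain ⟨δ₀, hδ₀, hcollar⟩ := collarAgreement D η hη
  refine ⟨δ₀, hδ₀, fun E hEΩ hE hEδ w hw ω p p' hne h => ?_⟩
  obtain ⟨ht, -, hst⟩ := cTgt_not_iff_of_nextCorner_eq hne h
  refine ⟨?_, ht, hst⟩
  by_contra hdeep
  rw [not_lt] at hdeep
  have := (no_discrepancy_of_agree hE.delta_pos.le (hcollar E hEΩ hE hEδ w hw ω p.1 hdeep) p.2
    (E.bcBondConfig ω)).1
  rw [Prod.mk.eta] at this
  exact hst this

end

end Summit.CriticalPhenomena.CardyFormulaZ2.Cruxes.EdgePrecompact.QkzStripBoundaryArm
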